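import Mathlib
import HarnessLib
import Summits.HubbardSuperconductivity.HubbardSuperconductivity.Theorems.KLProgrammeKLRegimeTwoVolumeSourceSmoothKit
import Summits.HubbardSuperconductivity.HubbardSuperconductivity.Theorems.KLProgrammeKLRegimeTwoVolumeSpineDataDefs
import Summits.HubbardSuperconductivity.HubbardSuperconductivity.Theorems.KLProgrammeKLRegimeTwoVolumeSectorBlockShift
import Summits.HubbardSuperconductivity.HubbardSuperconductivity.Theorems.KLProgrammeKLRegimeTwoVolumeStepProfileKit
import Summits.HubbardSuperconductivity.HubbardSuperconductivity.Theorems.KLProgrammeKLRegimeTwoVolumeSourceSmoothStateKit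
import Summits.HubbardSuperconductivity.HubbardSuperconductivity.Theorems.KLProgrammeKLRegimeTwoVolumeTowerSpineKit

/-!
# Route `KLProgramme` — crux K3, VL child (stmt-HubbardSuperconductivity-20440), keying option «(VL)-SRC-WINDOW»: THE SMOOTHING MATRIX IS A WEIGHTED
# TRANSFER (`TransferWtData`), HENCE WEIGHTED PROFILES SURVIVE THE SMOOTHING (seat hubbard-kl-k3c4-p1 g16, filed by g17 under the pen's (R235) «KEY = WINDOW») — item (w3) of VL-SRC-WINDOW-g16.md

The weights of `WtProfileRaw/WtProfileEven` and of `TransferWtData` see the SPATIAL sites only (`Λ·tnorm(x⃗ − y⃗)`); the smoothing `srcSmoothMat` is diagonal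
in the site and acts on time, so its weighted rows/columns are its plain rows/columns: `1` on the alive copy, `‖W_c(τ,·)‖_{ℓ¹} ≤ C_W` on the source copy
(`…TwoVolumeSourceSmoothKit.sum_norm_srcSmoothKernel_row_le/_col_le`); block covariance holds because the matrix depends on the sites only through their
equality (translation by `L·δ` on both legs).  Hence `TransferWtData (srcSmoothMat (b·L) M n) (klBlockEquivD …) (klBlockEquivD …) Λ_T (max 1 C_W)` for every
`Λ_T ≥ 0`, and `…StepProfileKit.wtProfileEven_map_of_wtProfileRaw` turns a raw weighted profile of `X` into an even weighted profile of `srcSmooth X`.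

* `srcSmoothMat_translate`, `srcSmoothMat_eq_zero_of_site_ne`, `sum_norm_srcSmoothMat_row_le/_col_le`, **`transferWtData_srcSmoothMat`**,
  **`wtProfileEven_srcSmooth_of_wtProfileRaw`**.

Proofs only.  [cite: BenfattoGiulianiMastropietro2006, (2.71a)]
-/

noncomputable section

namespace Summit.HubbardSuperconductivity.HubbardSuperconductivity.Theorems.TwoVolumeSource

set_option linter.dupNamespace false -- summit = problem name (single-conjunct summit), D-0017

open Finset Complex Literature.MathematicalPhysics.QuantumLattice Literature.Probability.LatticeModels GrassmannAlgebra
open Summit.HubbardSuperconductivity.HubbardSuperconductivity.Theorems.TwoPointAssembly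
open Summit.HubbardSuperconductivity.HubbardSuperconductivity.Theorems.TwoVolumeDefect
open scoped Real

/-- The torus sup-norm of the zero site vanishes (local copy). [folklore] -/
private theorem tnorm_zero_loc' {d L : ℕ} [NeZero L] : Torus.tnorm (0 : TorusSite d L) = 0 := by
  have h : Torus.tnorm (0 : TorusSite d L) ≤ Site.supNorm (0 : Site d) := by
    have h1 := Torus.tnorm_proj_le (L := L) (0 : Site d)
    have h0 : Torus.proj L (0 : Site d) = 0 := by
      funext i
      simp [Torus.proj_apply]
    rwa [h0] at h1
  have h2 : Site.supNorm (0 : Site d) = 0 := by simp [Site.supNorm]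
  exact le_antisymm (h2 ▸ h) (Nat.zero_le _)

section Matrix

variable {V M n : ℕ}

/-- **The smoothing matrix vanishes between different sites.** -/
theorem srcSmoothMat_eq_zero_of_site_ne (p q : SrcLabel V M n) (h : p.1.1.2 ≠ q.1.1.2) : srcSmoothMat V M n p q = 0 := by
  rw [srcSmoothMat_apply]
  by_cases hc0 : p.2 = 0 ∧ q.2 = 0
  · rw [if_pos hc0, if_neg (fun h1 : p.1 = q.1 => h (congrArg (fun z : SpaceTimeIdx V M × SectorLeg (sectorCount n) => z.1.2) h1))]
  · rw [if_neg hc0]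
    by_cases hc1 : p.2 = 1 ∧ q.2 = 1
    · rw [if_pos hc1, if_neg (fun h2 : p.1.1.2 = q.1.1.2 ∧ p.1.2 = q.1.2 => h h2.1)]
    · rw [if_neg hc1]

/-- **The smoothing matrix is invariant under a common spatial translation of both legs.** -/
theorem srcSmoothMat_translate (c : TorusSite 2 V) (t₁ t₂ : ImagTimeIdx M) (s₁ s₂ : TorusSite 2 V) (ℓ₁ ℓ₂ : SectorLeg (sectorCount n)) (u₁ u₂ : Fin 2) :
    srcSmoothMat V M n (((t₁, s₁ + c), ℓ₁), u₁) (((t₂, s₂ + c), ℓ₂), u₂) = srcSmoothMat V M n (((t₁, s₁), ℓ₁), u₁) (((t₂, s₂), ℓ₂), u₂) := by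
  rw [srcSmoothMat_apply, srcSmoothMat_apply]
  have hsite : (s₁ + c = s₂ + c) ↔ (s₁ = s₂) := add_left_inj c
  have hpair : (((t₁, s₁ + c), ℓ₁) = ((t₂, s₂ + c), ℓ₂)) ↔ (((t₁, s₁), ℓ₁) = ((t₂, s₂), ℓ₂)) := by
    simp only [Prod.mk.injEq, hsite]
  simp only [hpair, hsite]

end Matrix

section Rows

variable {V M n : ℕ} [NeZero V]

/-- **Weighted = plain for a site-diagonal matrix**: each term of a `Λ_T`-weighted row/column of the smoothing is the plain term. -/
theorem norm_srcSmoothMat_mul_weight (ΛT : ℝ) (p q : SrcLabel V M n) :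
    ‖srcSmoothMat V M n p q‖ * (1 + ΛT * (Torus.tnorm (p.1.1.2 - q.1.1.2) : ℝ)) = ‖srcSmoothMat V M n p q‖ := by
  by_cases h : p.1.1.2 = q.1.1.2
  · rw [h, sub_self, tnorm_zero_loc', Nat.cast_zero, mul_zero, add_zero, mul_one]
  · rw [srcSmoothMat_eq_zero_of_site_ne p q h, norm_zero, zero_mul]

/-- **Plain rows of the smoothing**: `1` on the alive copy, `Σ_{τ′} ‖W_c(τ,τ′)‖` on the source copy. -/
theorem sum_norm_srcSmoothMat_row_le {Cw : ℝ} (hCw : ∀ (c : Fin 2) (τ : ImagTimeIdx M), ∑ τ' : ImagTimeIdx M, ‖srcSmoothKernel M c τ τ'‖ ≤ Cw)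
    (p : SrcLabel V M n) : ∑ q, ‖srcSmoothMat V M n p q‖ ≤ max 1 Cw := by
  classical
  obtain ⟨⟨⟨τ, x⟩, ℓ⟩, s⟩ := p
  by_cases hs : s = 0
  · subst hs
    have hterm : ∀ q : SrcLabel V M n, ‖srcSmoothMat V M n (((τ, x), ℓ), 0) q‖ = if (((τ, x), ℓ), (0 : Fin 2)) = q then 1 else 0 := by
      intro q
      rw [srcSmoothMat_apply_of_alive (((τ, x), ℓ), 0) q rfl]
      split_ifs <;> simp
    rw [Fintype.sum_congr _ _ hterm, Finset.sum_ite_eq univ, if_pos (mem_univ _)]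
    exact le_max_left _ _
  · have hs1 : s = 1 := fin_two_eq_one_of_ne_zero hs
    subst hs1
    refine le_trans ?_ ((hCw ℓ.2 τ).trans (le_max_right _ _))
    -- only source columns with the same site and leg contribute
    have hterm : ∀ q : SrcLabel V M n, ‖srcSmoothMat V M n (((τ, x), ℓ), 1) q‖ =
        if q.2 = 1 ∧ q.1.1.2 = x ∧ q.1.2 = ℓ then ‖srcSmoothKernel M ℓ.2 τ q.1.1.1‖ else 0 := by
      intro q
      obtain ⟨⟨⟨qτ, qx⟩, qℓ⟩, qc⟩ := q
      by_cases hq1 : qc = 1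
      · subst hq1
        rw [srcSmoothMat_apply_of_src n _ _ rfl rfl]
        dsimp only
        by_cases hm : x = qx ∧ ℓ = qℓ
        · obtain ⟨h1, h2⟩ := hm; subst h1; subst h2
          rw [if_pos ⟨rfl, rfl⟩, if_pos ⟨rfl, rfl, rfl⟩]
        · rw [if_neg hm, norm_zero, if_neg (fun h => hm ⟨h.2.1.symm, h.2.2.symm⟩)]
      · have hq0 : qc = 0 := by by_contra h; exact hq1 (fin_two_eq_one_of_ne_zero h)
        subst hq0
        rw [srcSmoothMat_offDiag V M n ((τ, x), ℓ) 1 ((qτ, qx), qℓ) 0 (by decide), norm_zero, if_neg (fun h => absurd h.1 (by simp))]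
    rw [Fintype.sum_congr _ _ hterm, ← Finset.sum_filter]
    refine le_of_eq (Finset.sum_nbij' (fun q => q.1.1.1) (fun τ'' => (((τ'', x), ℓ), 1)) ?_ ?_ ?_ ?_ ?_)
    · intro q _; exact mem_univ _
    · intro τ'' _; simp only [mem_filter, mem_univ, and_self]
    · intro q hq
      simp only [mem_filter, mem_univ, true_and] at hq
      obtain ⟨⟨⟨qτ, qx⟩, qℓ⟩, qc⟩ := q
      simp only at hq ⊢
      obtain ⟨h1, h2, h3⟩ := hq
      subst h1; subst h2; subst h3; rfl
    · intro τ'' _; rfl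
    · intro q _; rfl

/-- **Plain columns of the smoothing.** -/
theorem sum_norm_srcSmoothMat_col_le {Cw : ℝ} (hCw : ∀ (c : Fin 2) (τ' : ImagTimeIdx M), ∑ τ : ImagTimeIdx M, ‖srcSmoothKernel M c τ τ'‖ ≤ Cw)
    (q : SrcLabel V M n) : ∑ p, ‖srcSmoothMat V M n p q‖ ≤ max 1 Cw := by
  classical
  obtain ⟨⟨⟨τ, x⟩, ℓ⟩, s⟩ := q
  by_cases hs : s = 0
  · subst hs
    have hterm : ∀ p : SrcLabel V M n, ‖srcSmoothMat V M n p (((τ, x), ℓ), 0)‖ = if p = (((τ, x), ℓ), (0 : Fin 2)) then 1 else 0 := by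
      intro p
      by_cases hp : p.2 = 0
      · rw [srcSmoothMat_apply_of_alive p _ hp]
        split_ifs <;> simp
      · obtain ⟨y, u⟩ := p
        have hu : u = 1 := fin_two_eq_one_of_ne_zero hp
        subst hu
        rw [srcSmoothMat_offDiag V M n y 1 ((τ, x), ℓ) 0 (by decide), norm_zero, if_neg (fun h => absurd (congrArg Prod.snd h) (by simp))]
    rw [Fintype.sum_congr _ _ hterm, Finset.sum_ite_eq' univ, if_pos (mem_univ _)]
    exact le_max_left _ _
  · have hs1 : s = 1 := fin_two_eq_one_of_ne_zero hs
    subst hs1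
    refine le_trans ?_ ((hCw ℓ.2 τ).trans (le_max_right _ _))
    have hterm : ∀ p : SrcLabel V M n, ‖srcSmoothMat V M n p (((τ, x), ℓ), 1)‖ =
        if p.2 = 1 ∧ p.1.1.2 = x ∧ p.1.2 = ℓ then ‖srcSmoothKernel M ℓ.2 p.1.1.1 τ‖ else 0 := by
      intro p
      obtain ⟨⟨⟨pτ, px⟩, pℓ⟩, pc⟩ := p
      by_cases hp1 : pc = 1
      · subst hp1
        rw [srcSmoothMat_apply_of_src n _ _ rfl rfl]
        dsimp only
        by_cases hm : px = x ∧ pℓ = ℓ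
        · obtain ⟨h1, h2⟩ := hm; subst h1; subst h2
          rw [if_pos ⟨rfl, rfl⟩, if_pos ⟨rfl, rfl, rfl⟩]
        · rw [if_neg hm, norm_zero, if_neg (fun h => hm ⟨h.2.1, h.2.2⟩)]
      · have hp0 : pc = 0 := by by_contra h; exact hp1 (fin_two_eq_one_of_ne_zero h)
        subst hp0
        rw [srcSmoothMat_offDiag V M n ((pτ, px), pℓ) 0 ((τ, x), ℓ) 1 (by decide), norm_zero, if_neg (fun h => absurd h.1 (by simp))]
    rw [Fintype.sum_congr _ _ hterm, ← Finset.sum_filter]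
    refine le_of_eq (Finset.sum_nbij' (fun p => p.1.1.1) (fun τ'' => (((τ'', x), ℓ), 1)) ?_ ?_ ?_ ?_ ?_)
    · intro p _; exact mem_univ _
    · intro τ'' _; simp only [mem_filter, mem_univ, and_self]
    · intro p hp
      simp only [mem_filter, mem_univ, true_and] at hp
      obtain ⟨⟨⟨pτ, px⟩, pℓ⟩, pc⟩ := p
      simp only at hp ⊢
      obtain ⟨h1, h2, h3⟩ := hp
      subst h1; subst h2; subst h3; rfl
    · intro τ'' _; rfl
    · intro p _; rfl

end Rows

section Transfer

variable {L b M n : ℕ} [NeZero L] [NeZero (b * L)]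

/-- **THE SMOOTHING IS A WEIGHTED TRANSFER** on the fine volume `b·L` (any `Λ_T ≥ 0`, constant `max 1 C_W`). [cite: BenfattoGiulianiMastropietro2006, (2.71a)] -/
theorem transferWtData_srcSmoothMat {Cw ΛT : ℝ} (hΛT : 0 ≤ ΛT)
    (hCr : ∀ (c : Fin 2) (τ : ImagTimeIdx M), ∑ τ' : ImagTimeIdx M, ‖srcSmoothKernel M c τ τ'‖ ≤ Cw)
    (hCc : ∀ (c : Fin 2) (τ' : ImagTimeIdx M), ∑ τ : ImagTimeIdx M, ‖srcSmoothKernel M c τ τ'‖ ≤ Cw) :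
    TransferWtData (srcSmoothMat (b * L) M n) (klBlockEquivD L b M n) (klBlockEquivD L b M n) ΛT (max 1 Cw) where
  ΛT_nonneg := hΛT
  cW_nonneg := le_trans zero_le_one (le_max_left _ _)
  row x := by
    simp_rw [norm_srcSmoothMat_mul_weight]
    exact sum_norm_srcSmoothMat_row_le hCr x
  col y' := by
    simp_rw [norm_srcSmoothMat_mul_weight]
    exact sum_norm_srcSmoothMat_col_le hCc y'
  cov δ β' β xbar y := by
    obtain ⟨xb, s⟩ := xbar
    obtain ⟨yb, u⟩ := y
    rw [klBlockEquivD_symm_apply, klBlockEquivD_symm_apply, klBlockEquivD_symm_apply, klBlockEquivD_symm_apply,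
      sectorBlock_symm_add_eq (rfl : b * L = b * L) (klBlockEquiv L b M (sectorCount n)) (klBlockEquiv_val L b M _) (klBlockEquiv_snd L b M _) β' δ xb,
      sectorBlock_symm_add_eq (rfl : b * L = b * L) (klBlockEquiv L b M (sectorCount n)) (klBlockEquiv_val L b M _) (klBlockEquiv_snd L b M _) β δ yb]
    set X₁ := (klBlockEquiv L b M (sectorCount n)).symm (β', xb)
    set X₂ := (klBlockEquiv L b M (sectorCount n)).symm (β, yb)
    have h1 : (X₁, s) = (((X₁.1.1, X₁.1.2), X₁.2), s) := by simp only [Prod.mk.eta]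
    have h2 : (X₂, u) = (((X₂.1.1, X₂.1.2), X₂.2), u) := by simp only [Prod.mk.eta]
    rw [h1, h2, srcSmoothMat_translate]

/-- **WEIGHTED PROFILES SURVIVE THE SMOOTHING**: a raw weighted profile of `X` at rate `Λ₁ ≥ Λ` yields an even weighted profile of `srcSmooth X` at rate `Λ`
with budgets `c^{2m′}·N(2m′)`, `c = max 1 C_W`. [cite: BenfattoGiulianiMastropietro2006, (2.71a)] -/
theorem wtProfileEven_srcSmooth_of_wtProfileRaw {Cw : ℝ}
    (hCr : ∀ (c : Fin 2) (τ : ImagTimeIdx M), ∑ τ' : ImagTimeIdx M, ‖srcSmoothKernel M c τ τ'‖ ≤ Cw)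
    (hCc : ∀ (c : Fin 2) (τ' : ImagTimeIdx M), ∑ τ : ImagTimeIdx M, ‖srcSmoothKernel M c τ τ'‖ ≤ Cw)
    {Λ Λ₁ : ℝ} (hΛ : 0 ≤ Λ) (hΛ₁ : Λ ≤ Λ₁) (X : GrassmannAlgebra ℂ (SrcLabel (b * L) M n)) {NW : ℕ → ℝ} (hW : WtProfileRaw X Λ₁ NW) :
    WtProfileEven (srcSmooth (b * L) M n X) Λ (fun m' => (max 1 Cw) ^ (2 * m' - 1) * ((max 1 Cw) * NW (2 * m'))) := by
  rw [srcSmooth_apply]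
  exact wtProfileEven_map_of_wtProfileRaw (srcSmoothMat (b * L) M n) (klBlockEquivD L b M n) (klBlockEquivD L b M n)
    (transferWtData_srcSmoothMat (ΛT := Λ) hΛ hCr hCc) hΛ le_rfl hΛ₁ X hW

end Transfer

/-! ## One volume: the trivial block structure, the profile bridge, the smoothed one-volume bundle -/

section Single

variable {V M n : ℕ} [NeZero V]

/-- **THE SMOOTHING IS A WEIGHTED TRANSFER on a single volume** (trivial block structure `Y ↦ (0, Y)`). [cite: BenfattoGiulianiMastropietro2006, (2.71a)] -/
theorem transferWtData_srcSmoothMat_single {Cw ΛT : ℝ} (hΛT : 0 ≤ ΛT)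
    (hCr : ∀ (c : Fin 2) (τ : ImagTimeIdx M), ∑ τ' : ImagTimeIdx M, ‖srcSmoothKernel M c τ τ'‖ ≤ Cw)
    (hCc : ∀ (c : Fin 2) (τ' : ImagTimeIdx M), ∑ τ : ImagTimeIdx M, ‖srcSmoothKernel M c τ τ'‖ ≤ Cw) :
    TransferWtData (srcSmoothMat V M n) (Equiv.uniqueProd (SrcLabel V M n) (Fin 2 → Fin 1)).symm
      (Equiv.uniqueProd (SrcLabel V M n) (Fin 2 → Fin 1)).symm ΛT (max 1 Cw) where
  ΛT_nonneg := hΛT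
  cW_nonneg := le_trans zero_le_one (le_max_left _ _)
  row x := by
    simp_rw [norm_srcSmoothMat_mul_weight]
    exact sum_norm_srcSmoothMat_row_le hCr x
  col y' := by
    simp_rw [norm_srcSmoothMat_mul_weight]
    exact sum_norm_srcSmoothMat_col_le hCc y'
  cov δ β' β xbar y := by
    simp only [Equiv.symm_symm, Equiv.uniqueProd_apply]

/-- A monotonicity helper for even weighted profiles. [folklore] -/
theorem wtProfileEven_mono' {Ns : ℕ} {W : GrassmannAlgebra ℂ ((SpaceTimeIdx V M × SectorLeg Ns) × Fin 2)} {Λ : ℝ} {N N' : ℕ → ℝ}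
    (h : WtProfileEven W Λ N) (hle : ∀ m', N m' ≤ N' m') : WtProfileEven W Λ N' where
  nonneg m' := (h.nonneg m').trans (hle m')
  le m' j x := (h.le m' j x).trans (hle m')

/-- **WEIGHTED PROFILES SURVIVE THE SMOOTHING (one volume)**. [cite: BenfattoGiulianiMastropietro2006, (2.71a)] -/
theorem wtProfileEven_srcSmooth_of_wtProfileRaw' {Cw : ℝ}
    (hCr : ∀ (c : Fin 2) (τ : ImagTimeIdx M), ∑ τ' : ImagTimeIdx M, ‖srcSmoothKernel M c τ τ'‖ ≤ Cw)
    (hCc : ∀ (c : Fin 2) (τ' : ImagTimeIdx M), ∑ τ : ImagTimeIdx M, ‖srcSmoothKernel M c τ τ'‖ ≤ Cw)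
    {Λ Λ₁ : ℝ} (hΛ : 0 ≤ Λ) (hΛ₁ : Λ ≤ Λ₁) (X : GrassmannAlgebra ℂ (SrcLabel V M n)) {NW : ℕ → ℝ} (hW : WtProfileRaw X Λ₁ NW) :
    WtProfileEven (srcSmooth V M n X) Λ (fun m' => (max 1 Cw) ^ (2 * m' - 1) * ((max 1 Cw) * NW (2 * m'))) := by
  rw [srcSmooth_apply]
  exact wtProfileEven_map_of_wtProfileRaw (srcSmoothMat V M n) _ _ (transferWtData_srcSmoothMat_single (ΛT := Λ) hΛ hCr hCc) hΛ le_rfl hΛ₁ X hW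

/-- **THE SMOOTHED ONE-VOLUME BUNDLE FROM THE RESCALED ONE**: `TowerVolumeDataTS … NV ⇒ TowerVolumeDataTSW … NV′` with
`NV′ j m = c^{2m−1}·c·NV j m`, `c = max 1 C_W` (partition functions, parity, covariance bundles unchanged; profiles through the bridge).
[cite: BenfattoGiulianiMastropietro2006, (2.71a), §2.9 (4.6)-(4.8)] -/
theorem TowerVolumeDataTS.smooth {β U μ : ℝ} {K : TrigPolyC4v} {J : ℕ} {ε t : ℝ} {Λ κ aW sW : ℕ → ℝ} {NV : ℕ → ℕ → ℝ} {Cw : ℝ}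
    (hCr : ∀ (c : Fin 2) (τ : ImagTimeIdx M), ∑ τ' : ImagTimeIdx M, ‖srcSmoothKernel M c τ τ'‖ ≤ Cw)
    (hCc : ∀ (c : Fin 2) (τ' : ImagTimeIdx M), ∑ τ : ImagTimeIdx M, ‖srcSmoothKernel M c τ τ'‖ ≤ Cw)
    (hΛ : ∀ j, 0 ≤ Λ j) (hd : TowerVolumeDataTS V M β U μ K J ε t Λ κ aW sW NV) :
    TowerVolumeDataTSW V M β U μ K J ε t Λ κ aW sW (fun j m => (max 1 Cw) ^ (2 * m - 1) * (max 1 Cw) * NV j m) where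
  Z := hd.Z
  parity := hd.parity
  cov := hd.cov
  profile j hj := by
    -- the truncated rescaled read-out is even: its even profile is a raw profile
    have he : srcTrunc ℂ (fun q : SrcLabel V M j => q.2 = 1) 3 (klTowerDS V M β U μ K t j) ∈ evenOdd ℂ 0 :=
      (srcTrunc_klTowerDS_parity_of_parity β U μ K t j 3 (hd.parity j hj)).1
    have hraw := wtProfileRaw_of_wtProfileEven he (hd.profile j hj)
    have hb := wtProfileEven_srcSmooth_of_wtProfileRaw' (n := j) hCr hCc (hΛ j) le_rfl _ hraw
    rw [srcSmooth_srcTrunc_comm, ← klTowerDSW_eq] at hb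
    refine wtProfileEven_mono' hb fun m' => le_of_eq ?_
    have h2 : Even (2 * m') := even_two_mul m'
    rw [if_pos h2, Nat.mul_div_cancel_left m' (by norm_num : 0 < 2)]
    ring

end Single

end Summit.HubbardSuperconductivity.HubbardSuperconductivity.Theorems.TwoVolumeSource

end
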